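import Summits.QuantumFields.YangMills.Theorems.ParabolicTrajectoryContinuumLimitOnTrajectoryDefs
import Literature.MathematicalPhysics.QuantumFieldTheory.Sweep1ShenZhuZhuProofs

/-!
# Stub `stub_osLegs : OneFieldOSLegs` (line `two-orbit-synchronisation`, crux stmt-QuantumFields-10522) — VERDICT: MIS-STATED; the CORRECTED stub is PROVED here

Work file of the stub worker. Outcome `stub-misstated`: two hypotheses are missing — an E2 input (`ARP`) and an
E4 input (`UCL`), §D. With them added the statement `OneFieldOSLegs'` (§D) is PROVED in this file
(`oneFieldOSLegs'`, §H; rc 0, no `sorry`, axioms `propext/Classical.choice/Quot.sound` only), and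
`stub_osLegs_of_ARP_UCL` shows how the REGISTERED statement follows once the line supplies `ARP ∧ UCL` for the
scheme (its gap hypotheses are idle). Engine: ultralimit of the canonical curvature distributions on `⁰𝒮` along one
ultrafilter `𝒰 ≥ atTop` + Hahn–Banach on the polynormable Schwartz space (§C, §E) — no density theorem, no
Banach–Steinhaus, no OS reconstruction; zero-extension to all species (§G); E0-hermiticity from E2 by the
Kravchuk–Qiao–Rychkov `2 × 2` argument, proved as a general lemma on labelled Schwinger families (§F).

## 1. E4 (`HasClusterProperty`) is NOT derivable from {`HasLatticeMassGap` (as typed), `UVB`, `ConvProducts`,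
`AsympEuclid`, RP of Wilson} — exact point of failure

Tree E4 (`LabelledSchwingerFamily.HasClusterProperty`) is QUALITATIVE and SPATIAL: for time-ordered `F, G`, spatial
`a ≠ 0` (`a 0 = 0`), `𝔖_{n+m}(θF* ⊗ T_{ta}G) − 𝔖ₙ(θF*)𝔖ₘ(G) → 0` as `t → ∞`. For the would-be limit this is
`lim_t lim_k [curvDistribution k (n+m) (θF* ⊗ T_{ta}G) − curvDistribution k n (θF*) · curvDistribution k m G]`,
a truncated correlation, on the scheme's OWN torus `2L_k+1` at `β_k`, of the two composites
`X_k = ∑_{x⃗} F(a_k x⃗) ∏ᵢ P̃_{xᵢ}` and `Y_k = ∑_{y⃗} G(a_k y⃗) ∏ⱼ P̃_{yⱼ}` (`P̃ = P − ⟨P⟩_k`, `c a⁴ = 1` per point),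
at spatial lattice separation `s = t|a|/a_k`.
(a) Direction is harmless: after an E1-rotation (AsympEuclid) `a ∥ e₁`, and the axis swap `0 ↔ 1` is an exact
    symmetry of Wilson's torus measure AND of `r.curvature` (= sum over all six corner plaquettes), so the
    quantity is a TIME correlation at separation `s` of swapped composites.
(b) THE FAILURE: `HasLatticeMassGap r sch Δ` reads `∀ A B : YMSpecies G, ∃ C, ∀ᶠ k, ∀ S ≥ L_k, ∀ n ≤ S,
    |⟨A;τₙB⟩_{k,S}| ≤ C e^{−Δ a_k n}` with `C = C(A,B)` and NO uniformity in the pair. By multilinearity the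
    composite correlation is `∑_{x⃗,y⃗} F(a_k x⃗)G(a_k y⃗) ⟨∏P̃_{xᵢ} ; τ_s ∏P̃_{yⱼ}⟩`: the species involved
    (`∏ᵢ P ∘ τ_{xᵢ−x₁}`, and already for `n = m = 1` the spatial translates `P ∘ τ_{z⃗}`, `|z⃗| ≲ R/a_k`) form a
    family that GROWS with `k`; the hypothesis gives one constant per member, so neither `∑ C` nor `sup C` over
    the `O(a_k^{-4(n+m)})` terms is controlled, at any `t`. (Even a constant uniform over species PAIRS would
    give the composite only `∑_pairs C ≍ a_k^{-4(n+m)}‖F‖₁‖G‖₁ C`, i.e. `|…| ≤ a_k^{-4(n+m)} C' e^{−Δ|a|t}`: no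
    `t₀(ε)` uniform in `k` by direct bounding — the "unscaled" defect of Disproof §R F3.)
(c) The RP/log-convexity rescue fails at two named points. (c1) With `g_k(s) := ⟨θX_k ; τ_s X_k⟩ᶜ_{k}` (RP
    Cauchy–Schwarz reduces the cross term to the two diagonal ones), log-convexity + monotonicity in `s` hold for
    the INFINITE time-extent transfer-matrix representation `g(s) = ∫ λ^s dν`, `ν ≥ 0`; on the torus of period
    `P_k = 2L_k+1` one has instead `Z⁻¹Tr(T^{P_k−s} X̂* T^s X̂) − |Z⁻¹Tr(T^{P_k}X̂)|²`, whose vacuum subtraction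
    breaks log-convexity by terms of RELATIVE size `e^{−m_k(P_k − s)}` (`m_k` = lattice gap) against amplitudes
    `‖X_k‖² ≲ a_k^{−8n}`; since `a_k L_k → ∞` at NO specified rate (e.g. `a_k L_k = log log a_k⁻¹` is a legal
    scheme), `a_k^{-8n} e^{−Δ a_k(2L_k+1)} ↛ 0` in general. (c2) Even granting exact log-convexity, the
    interpolation `g_k(t/a_k) ≤ g_k(t₀/a_k)^{1−θ} g_k(T/a_k)^θ` needs a LARGE-`T` anchor `g_k(T/a_k) ≤ C e^{−ΔT}`
    with ONE `C` for all `k` (for the diagonal correlator of the composite `X_k`); the only source is (b), whose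
    constant is attached to each species pair, hence to each `k` separately (`C_k ≍ a_k^{-8n} · max_pairs C`).
    [If some `C` worked for all `k`, letting `T → ∞` WOULD give `g_k(t/a_k) ≤ UVB · e^{−Δ(t−t₀)}` — so the
    failure is exactly the per-pair, hence per-`k`, constant, not the absence of a rate in E4.]
(d) The infinite-volume detour (`S → ∞` at fixed `k`: RP transfer matrix, spectral theorem, gap from the
    `S`-uniform clause ⇒ `g_X(s) ≤ e^{−Δ a_k (s−s₀)} g_X(s₀)` for EVERY local `X`, composites included) needs
    (d1) UVB in infinite volume and (d2) `lim_k` (own torus) = `lim_k` (infinite volume) for the E4 quantity —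
    i.e. SCALED finite-size independence at physical scale (the content of `stub_volume` (a), for general
    off-diagonal tensors), which is not among the hypotheses. Conclusion: E4 needs its own scaled hypothesis;
    the honest minimal one is `UCL` below (spatial, qualitative, `k`-uniform: exactly what passes to the limit).

## 2. Second hole: E2 (and E0-hermiticity) are NOT derivable from UVB-for-curvature-strings + exact lattice RP

`r.curvature = ∑_{μ<ν} Re tr U(∂p_{μν}(0))` (corner plaquettes). Under ANY time reflection `Θ` (site plane
`x⁰ = 0` or link plane `x⁰ = ½`; on the odd torus one plane of each kind) `P_z ∘ Θ = R_{θz} + Q_{θz−e₀}` resp.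
`Q_{θz} + R_{θz+e₀}` (`Q` = the three time-like, `R` = the three space-like corner plaquettes): the pattern is NOT
a translate of `P` (space-like plaquettes sit at the bottom time of the time-like ones; a reflection puts them on
top; spatial symmetries do not move times). Hence, with `A(F) = ∑ F(a x⃗)∏P̃_{xᵢ} ∈ 𝔄₊` for time-ordered `F`,
`∑ᵢⱼ curvDistribution k (θFᵢ* ⊗ Fⱼ) = ⟪X′, X⟫_RP` with `X = ∑ⱼ A(Fⱼ)` but `X′ = ∑ᵢ A^{(−)}(Fᵢ)` smeared with the
DOWNWARD density `P^{(−)} = R + Q∘τ_{−e₀}` — a CROSS entry of the positive-semidefinite RP Gram matrix of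
`(X, X′)`, which has no sign. `X′ − X` is, after summation by parts, a `Q`-insertion smeared with
`F(· − a_k e₀) − F = O(a_k)` in Schwartz norms, so `⟪X′−X, X′−X⟫ → 0` needs `k`-uniform E0'-type bounds for
MIXED strings over the alphabet `{Q, R}` — not implied by `UVB` (which bounds `P = Q + R` strings only; `Q`, `R`
are not functions of `P`). The same `Q`-insertion obstructs hermiticity from `Θ`-invariance of Wilson's measure
(hermiticity ⟺ reality + E3 + `θ`-invariance of the limit; `θ ∉ SO(4)`, so `AsympEuclid` does not supply it —
though hermiticity alone could be had from the exact axis-transposition symmetry `(det −1) ∘ SO(4)`; E2 cannot).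
Minimal honest input: `ARP` below (= the format of `OSData.reflectionPositive`, passed `ε`-approximately; it also
yields hermiticity by the `2 × 2` argument of Kravchuk–Qiao–Rychkov Rem. 2.2 with a degree-`0` term). The sibling
support item `OSLimitFromUniformBounds` (stmt-QuantumFields-9120, route FlowLineStateSpace) carries BOTH `(ARP)`
and `(CL)` as hypotheses for exactly these reasons; nothing of it has landed under `Theorems/`.

## 3. Obligation table for the corrected stub — ALL PROVED in §H (`LimitPkg.*`), from the pieces of §A–§G

| obligation | proved by |
|---|---|
| limit CLM on `⁰𝒮`, all `p`, one ultrafilter | `exists_clm_ultralimit` (§C), `exists_limitFunctionals` (§E), `curvCLM` (§A), `UVB` |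
| E0 normalisation | `curvDistribution_zero` (§A), `LimitPkg.normalized` |
| E0' | `UVB` through `le_of_tendsto` (`LimitPkg.linearGrowth`, `α ↦ max α 0`) |
| E1 | `AsympEuclid` + `isOffDiagonal_translateMulti/linActMulti` (§B), `LimitPkg.invariant` |
| E3 | `curvDistribution_permTest` (exact, §A) + `isOffDiagonal_permTest`, `LimitPkg.symmetric` |
| E2 | hypothesis `ARP`; zero strings drop out termwise, `LimitPkg.reflectionPositive` |
| E0 hermiticity | `isHermitian_of_isReflectionPositive` (§F, general) , `LimitPkg.hermitian` |
| E4 | hypothesis `UCL`; `isOffDiagonal_of_isAppendTensorOf` (§B), `LimitPkg.cluster` |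
| `IsYangMillsFor` | `curvDistribution_tensor`, `latticeSchwinger_canon_curv/_eq_zero` (§A), `ConvProducts`, `LimitPkg.isYangMillsFor` |
| `IsNontrivial` | `ND2` + `curvDistribution_one = 0` (exact centring, `torusState_map_configShift`), `LimitPkg.isNontrivial` |
| `IsNonGaussian` | `ND3` + `curvDistribution_one`, `LimitPkg.isNonGaussian` |
| `HasLatticeMassGap`, `0 < Δ` | idle (contribute nothing; dropped in `OneFieldOSLegs'`) |

## 4. Corrected signature (proposal; `ARP`, `UCL`, `OneFieldOSLegs'` of §D should move VERBATIM into the Defs file)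

`theorem stub_osLegs : OneFieldOSLegs'`, where
`def OneFieldOSLegs' : Prop := ∀ G … r sch, ConvProducts r sch → UVB r sch → AsympEuclid r sch → ARP r sch →
  UCL r sch → ND2 r sch → ND3 r sch → ∃ T : OSData (YMSpecies G) 4, IsYangMillsFor r (canon r sch) T ∧
  T.IsNontrivial r.curvature ∧ T.IsNonGaussian r.curvature` — proved below as `oneFieldOSLegs'`;
and `LimitRegularity` (or a new stub) owes `ARP r sch ∧ UCL r sch` (composition: `stub_osLegs_of_ARP_UCL`).
`UCL` is where a SCALED, `k`-uniform clustering of the trajectory must be proved (physically the mass gap at scale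
plus finite-size independence; formally new content); `ARP` is where the time-chirality defect `a⁻⁴ ∂₀R` of the
corner action density must be controlled (a mixed-alphabet E0' bound would do).
-/

set_option autoImplicit false

open scoped SchwartzMap
open MeasureTheory Filter Topology
open Literature.MathematicalPhysics.QuantumFieldTheory Literature.MathematicalPhysics.QuantumLattice
open Literature.MathematicalPhysics.AQFT Literature.Probability.LatticeModels
open Summit.QuantumFields.YangMills.Theses.ParabolicTrajectory

noncomputable section

namespace Summit.QuantumFields.YangMills.Cruxes.ContinuumLimitOnTrajectory.TwoOrbitSynchronisation

local notation "𝔼" => EuclideanSpace ℝ (Fin 4)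

/-! ## §A  Lattice-level identities of the canonical curvature distributions (class (i), proved) -/

section Lattice

open Literature.MathematicalPhysics.QuantumFieldTheory (torusState torusState_map_configShift measurable_torusLift)
open Literature.MathematicalPhysics.AQFT.LabelledSchwingerFamily (evalAt evalAt_apply)

/-- (disambiguation: the gauge-configuration translation of `QuantumLattice`, not the spin one of `LatticeModels`) -/
local notation "cfgShift" => Literature.MathematicalPhysics.QuantumLattice.configShift

variable {G : Type} [Group G] [TopologicalSpace G] [IsTopologicalGroup G] [CompactSpace G]
  [MeasurableSpace G] [BorelSpace G]

/-- The torus Wilson measure of the scheme at step `k`. -/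
abbrev μW (r : LatticeRep G) (sch : SpeciesScheme (YMSpecies G)) (k : ℕ) :
    Measure (GaugeConfig 4 (sch.side k) G) :=
  wilsonMeasure (d := 4) (L := sch.side k) r.ρ (sch.β k)

/-- It is a probability measure (continuity of `r.ρ`). -/
instance isProbabilityMeasure_μW (r : LatticeRep G) (sch : SpeciesScheme (YMSpecies G)) (k : ℕ) :
    IsProbabilityMeasure (μW r sch k) :=
  isProbabilityMeasure_wilsonMeasure (d := 4) (L := sch.side k) r.ρ r.continuous (sch.β k)

/-- The centred curvature weight at the lattice point `x` (the factor of `curvDistribution`; the canonical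
`c a⁴ = a⁻⁴ a⁴` is kept verbatim). -/
def cw (r : LatticeRep G) (sch : SpeciesScheme (YMSpecies G)) (k : ℕ) (x : Site 4)
    (U : GaugeConfig 4 (sch.side k) G) : ℝ :=
  ((sch.a k) ^ 4)⁻¹ * sch.a k ^ 4 *
    (r.curvature.F (cfgShift (-x) (torusLift (sch.side k) U)) -
      wilsonTorusMean r.ρ (sch.β k) (sch.L k) r.curvature.F)

/-- Unfolding `curvDistribution` through `cw`. -/
theorem curvDistribution_eq (r : LatticeRep G) (sch : SpeciesScheme (YMSpecies G)) (k p : ℕ)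
    (F : 𝓢((Fin p → 𝔼), ℂ)) :
    curvDistribution r sch k p F =
      ∫ U, ∑ x : Fin p → ↥(box 4 (sch.L k)), F (fun i => sch.a k • siteToE (↑(x i) : Site 4)) *
        ∏ i, ((cw r sch k (↑(x i)) U : ℝ) : ℂ) ∂(μW r sch k) := rfl

/-- The curvature weight is measurable in the configuration. -/
theorem measurable_cw (r : LatticeRep G) (sch : SpeciesScheme (YMSpecies G)) (k : ℕ) (x : Site 4) :
    Measurable (cw r sch k x) := by
  unfold cw
  refine measurable_const.mul (Measurable.sub ?_ measurable_const)
  exact r.curvature.measurable.comp ((cfgShift (-x)).measurable.comp (measurable_torusLift _))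

/-- The curvature weight is bounded (the species is bounded). -/
theorem exists_bound_cw (r : LatticeRep G) (sch : SpeciesScheme (YMSpecies G)) (k : ℕ) :
    ∃ C : ℝ, ∀ x U, |cw r sch k x U| ≤ C := by
  obtain ⟨C, hC⟩ := r.curvature.bounded
  refine ⟨|((sch.a k) ^ 4)⁻¹ * sch.a k ^ 4| *
    (C + |wilsonTorusMean r.ρ (sch.β k) (sch.L k) r.curvature.F|), fun x U => ?_⟩
  unfold cw
  rw [abs_mul]
  refine mul_le_mul_of_nonneg_left ((abs_sub _ _).trans (add_le_add (hC _) le_rfl)) (abs_nonneg _)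

/-- Products of curvature weights against a coefficient are integrable (bounded measurable functions on a
probability space). -/
theorem integrable_prod_cw (r : LatticeRep G) (sch : SpeciesScheme (YMSpecies G)) (k p : ℕ)
    (c : ℂ) (x : Fin p → Site 4) :
    Integrable (fun U => c * ∏ i, ((cw r sch k (x i) U : ℝ) : ℂ)) (μW r sch k) := by
  obtain ⟨C, hC⟩ := exists_bound_cw r sch k
  have hmeas : Measurable fun U => c * ∏ i, ((cw r sch k (x i) U : ℝ) : ℂ) :=
    measurable_const.mul (Finset.measurable_prod _ fun i _ =>
      Complex.measurable_ofReal.comp (measurable_cw r sch k (x i)))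
  refine Integrable.of_bound hmeas.aestronglyMeasurable (‖c‖ * |C| ^ p) (Eventually.of_forall fun U => ?_)
  rw [norm_mul, norm_prod]
  refine mul_le_mul_of_nonneg_left ?_ (norm_nonneg _)
  calc ∏ i, ‖((cw r sch k (x i) U : ℝ) : ℂ)‖ ≤ ∏ _i : Fin p, |C| :=
        Finset.prod_le_prod (fun i _ => norm_nonneg _) fun i _ => by
          rw [Complex.norm_real, Real.norm_eq_abs]; exact (hC _ _).trans (le_abs_self C)
    _ = |C| ^ p := by simp

/-- **Sum–integral interchange**: `curvDistribution` is a finite linear combination of point evaluations of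
the test function, with coefficients the torus expectations of products of centred curvature weights. -/
theorem curvDistribution_eq_sum (r : LatticeRep G) (sch : SpeciesScheme (YMSpecies G)) (k p : ℕ)
    (F : 𝓢((Fin p → 𝔼), ℂ)) :
    curvDistribution r sch k p F =
      ∑ x : Fin p → ↥(box 4 (sch.L k)), F (fun i => sch.a k • siteToE (↑(x i) : Site 4)) *
        ∫ U, ∏ i, ((cw r sch k (↑(x i)) U : ℝ) : ℂ) ∂(μW r sch k) := by
  rw [curvDistribution_eq, integral_finsetSum _ fun x _ => integrable_prod_cw r sch k p _ _]
  refine Finset.sum_congr rfl fun x _ => ?_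
  rw [integral_const_mul]

/-- `curvDistribution k p` as a continuous linear functional on `𝓢((ℝ⁴)ᵖ, ℂ)`. -/
def curvCLM (r : LatticeRep G) (sch : SpeciesScheme (YMSpecies G)) (k p : ℕ) :
    𝓢((Fin p → 𝔼), ℂ) →L[ℂ] ℂ :=
  ∑ x : Fin p → ↥(box 4 (sch.L k)),
    (∫ U, ∏ i, ((cw r sch k (↑(x i)) U : ℝ) : ℂ) ∂(μW r sch k)) •
      evalAt (fun i => sch.a k • siteToE (↑(x i) : Site 4))

/-- `curvCLM` is `curvDistribution`. -/
@[simp] theorem curvCLM_apply (r : LatticeRep G) (sch : SpeciesScheme (YMSpecies G)) (k p : ℕ)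
    (F : 𝓢((Fin p → 𝔼), ℂ)) : curvCLM r sch k p F = curvDistribution r sch k p F := by
  rw [curvDistribution_eq_sum, curvCLM, FunLike.coe_sum, Finset.sum_apply]
  refine Finset.sum_congr rfl fun x _ => ?_
  rw [FunLike.coe_smul, Pi.smul_apply, evalAt_apply, smul_eq_mul, mul_comm]

/-- Linearity consequences. -/
theorem curvDistribution_add (r : LatticeRep G) (sch : SpeciesScheme (YMSpecies G)) (k p : ℕ)
    (F F' : 𝓢((Fin p → 𝔼), ℂ)) :
    curvDistribution r sch k p (F + F') = curvDistribution r sch k p F + curvDistribution r sch k p F' := by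
  rw [← curvCLM_apply, ← curvCLM_apply, ← curvCLM_apply, map_add]

/-- Homogeneity. -/
theorem curvDistribution_smul (r : LatticeRep G) (sch : SpeciesScheme (YMSpecies G)) (k p : ℕ)
    (c : ℂ) (F : 𝓢((Fin p → 𝔼), ℂ)) :
    curvDistribution r sch k p (c • F) = c * curvDistribution r sch k p F := by
  rw [← curvCLM_apply, ← curvCLM_apply, map_smul, smul_eq_mul]

/-- Additivity (differences). -/
theorem curvDistribution_sub (r : LatticeRep G) (sch : SpeciesScheme (YMSpecies G)) (k p : ℕ)
    (F F' : 𝓢((Fin p → 𝔼), ℂ)) :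
    curvDistribution r sch k p (F - F') = curvDistribution r sch k p F - curvDistribution r sch k p F' := by
  rw [← curvCLM_apply, ← curvCLM_apply, ← curvCLM_apply, map_sub]

/-- The zero test function has zero distribution. -/
@[simp] theorem curvDistribution_zero_fun (r : LatticeRep G) (sch : SpeciesScheme (YMSpecies G)) (k p : ℕ) :
    curvDistribution r sch k p 0 = 0 := by
  rw [← curvCLM_apply, map_zero]

/-- **E0 (normalisation) at lattice level**: the `0`-point distribution is evaluation (probability measure). -/
theorem curvDistribution_zero (r : LatticeRep G) (sch : SpeciesScheme (YMSpecies G)) (k : ℕ)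
    (F : 𝓢((Fin 0 → 𝔼), ℂ)) : curvDistribution r sch k 0 F = F default := by
  rw [curvDistribution_eq_sum]
  simp only [Finset.univ_eq_empty, Finset.prod_empty, integral_const, probReal_univ, one_smul, mul_one]
  rw [Fintype.sum_unique]
  exact congrArg F (Subsingleton.elim _ _)

/-- **Translation invariance of the torus Wilson state, through the periodic lift**: the expectation of any
measurable observable composed with a lattice translation is unchanged. -/
theorem integral_comp_configShift_torusLift {N : ℕ} (ρ : G →* Matrix (Fin N) (Fin N) ℂ) (β : ℝ)
    (S : ℕ) [NeZero S] (v : Site 4) {O : LGConfig 4 G → ℝ} (hO : Measurable O) :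
    ∫ U, O (cfgShift v (torusLift S U)) ∂(wilsonMeasure (d := 4) (L := S) ρ β) =
      ∫ U, O (torusLift S U) ∂(wilsonMeasure (d := 4) (L := S) ρ β) := by
  have h1 : ∫ U, O (cfgShift v (torusLift S U)) ∂(wilsonMeasure (d := 4) (L := S) ρ β) =
      ∫ U, O (cfgShift v U) ∂(torusState (d := 4) ρ β S) := by
    rw [torusState, integral_map (measurable_torusLift S).aemeasurable]
    exact (hO.comp (cfgShift v).measurable).aestronglyMeasurable
  have h2 : ∫ U, O (torusLift S U) ∂(wilsonMeasure (d := 4) (L := S) ρ β) =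
      ∫ U, O U ∂(torusState (d := 4) ρ β S) := by
    rw [torusState, integral_map (measurable_torusLift S).aemeasurable hO.aestronglyMeasurable]
  rw [h1, h2, ← integral_map (cfgShift v).measurable.aemeasurable hO.aestronglyMeasurable,
    torusState_map_configShift]

/-- **Exact centring**: every centred curvature weight has torus mean zero. -/
theorem integral_cw (r : LatticeRep G) (sch : SpeciesScheme (YMSpecies G)) (k : ℕ) (x : Site 4) :
    ∫ U, cw r sch k x U ∂(μW r sch k) = 0 := by
  unfold cw
  rw [integral_const_mul, integral_sub, integral_const, probReal_univ, one_smul]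
  · have h := integral_comp_configShift_torusLift r.ρ (sch.β k) (sch.side k) (-x) r.curvature.measurable
    rw [mul_eq_zero]; right
    rw [sub_eq_zero, h]
    rfl
  · obtain ⟨C, hC⟩ := r.curvature.bounded
    exact Integrable.of_bound
      ((r.curvature.measurable.comp ((cfgShift (-x)).measurable.comp
        (measurable_torusLift _))).aestronglyMeasurable) C (Eventually.of_forall fun U => hC _)
  · exact integrable_const _

/-- **One-point functions vanish identically** (exact centring + translation invariance): the lattice
`IsNontrivial`/`IsNonGaussian` computations reduce to the 2- and 3-point distributions. -/
theorem curvDistribution_one (r : LatticeRep G) (sch : SpeciesScheme (YMSpecies G)) (k : ℕ)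
    (F : 𝓢((Fin 1 → 𝔼), ℂ)) : curvDistribution r sch k 1 F = 0 := by
  rw [curvDistribution_eq_sum]
  refine Finset.sum_eq_zero fun x _ => ?_
  have h : ∫ U, ∏ i, ((cw r sch k (↑(x i)) U : ℝ) : ℂ) ∂(μW r sch k) = 0 := by
    simp only [Finset.univ_unique, Fin.default_eq_zero, Finset.prod_singleton]
    rw [integral_complex_ofReal, integral_cw, Complex.ofReal_zero]
  rw [h, mul_zero]

/-- **E3 (symmetry) at lattice level, exactly**: relabelling the summation variables. -/
theorem curvDistribution_permTest (r : LatticeRep G) (sch : SpeciesScheme (YMSpecies G)) (k p : ℕ)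
    (π : Equiv.Perm (Fin p)) (F : 𝓢((Fin p → 𝔼), ℂ)) :
    curvDistribution r sch k p (permTest π F) = curvDistribution r sch k p F := by
  rw [curvDistribution_eq_sum, curvDistribution_eq_sum]
  -- reindex `x ↦ x ∘ π`
  refine Fintype.sum_equiv (Equiv.arrowCongr π.symm (Equiv.refl _)) _ _ fun x => ?_
  have hx : (Equiv.arrowCongr π.symm (Equiv.refl _)) x = x ∘ π := by
    funext i; simp [Equiv.arrowCongr_apply]
  rw [hx, permTest_apply]
  congr 1
  refine integral_congr_ae (Eventually.of_forall fun U => ?_)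
  exact (Fintype.prod_equiv π _ _ fun i => rfl).symm

/-- **Product tensors**: on a real product tensor the canonical distribution is the canonical `p`-point
function `curvNPoint` (sum–product interchange; the identity promised in the docstring of `curvDistribution`). -/
theorem curvDistribution_tensor (r : LatticeRep G) (sch : SpeciesScheme (YMSpecies G)) (k p : ℕ)
    {F : 𝓢((Fin p → 𝔼), ℂ)} {f : Fin p → 𝓢(𝔼, ℝ)} (hF : IsTensorOf F fun i => ofRealTest (f i)) :
    curvDistribution r sch k p F = ((curvNPoint r sch k p f : ℝ) : ℂ) := by
  classical
  have hc : (canon r sch).c r.curvature k = ((sch.a k) ^ 4)⁻¹ := by simp [canon]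
  -- unfold the right-hand side (the fields `a, β, L, side` of `canon r sch` are those of `sch`, by `rfl`)
  have hm : (canon r sch).m r.curvature k = wilsonTorusMean r.ρ (sch.β k) (sch.L k) r.curvature.F := rfl
  have hR : curvNPoint r sch k p f =
      ∫ U, ∑ x : Fin p → ↥(box 4 (sch.L k)),
        (∏ i, f i (sch.a k • siteToE (↑(x i) : Site 4))) * ∏ i, cw r sch k (↑(x i)) U ∂(μW r sch k) := by
    show ∫ U, ∏ i, smearedLatticeField r.curvature.F (box 4 (sch.L k)) (sch.a k)
        ((canon r sch).c r.curvature k) ((canon r sch).m r.curvature k) (f i) (torusLift (sch.side k) U)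
        ∂(μW r sch k) = _
    refine integral_congr_ae (Eventually.of_forall fun U => ?_)
    simp only [smearedLatticeField, hm]
    rw [hc]
    have hsum : ∀ i : Fin p,
        ((sch.a k) ^ 4)⁻¹ * sch.a k ^ 4 *
            ∑ x ∈ box 4 (sch.L k), f i (sch.a k • siteToE x) *
              (r.curvature.F (cfgShift (-x) (torusLift (sch.side k) U)) -
                wilsonTorusMean r.ρ (sch.β k) (sch.L k) r.curvature.F) =
          ∑ x : ↥(box 4 (sch.L k)), f i (sch.a k • siteToE (↑x : Site 4)) * cw r sch k (↑x) U := by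
      intro i
      rw [Finset.mul_sum, ← Finset.sum_coe_sort]
      refine Finset.sum_congr rfl fun x _ => ?_
      simp only [cw]
      ring
    simp_rw [hsum]
    rw [Finset.prod_univ_sum, Fintype.piFinset_univ]
    refine Finset.sum_congr rfl fun x _ => ?_
    rw [Finset.prod_mul_distrib]
  rw [hR, curvDistribution_eq, ← integral_complex_ofReal]
  refine integral_congr_ae (Eventually.of_forall fun U => ?_)
  push_cast
  refine Finset.sum_congr rfl fun x _ => ?_
  rw [hF]
  simp only [ofRealTest_apply]

omit [TopologicalSpace G] [IsTopologicalGroup G] [CompactSpace G] [BorelSpace G] in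
/-- **Species zeroing** (adapted from the sibling line `curtiss_flowed_free_energies`, `latticeSchwinger_canon_eq_zero`):
a string touching a species other than the curvature has identically vanishing canonical lattice functions. -/
theorem latticeSchwinger_canon_eq_zero [TopologicalSpace G] [IsTopologicalGroup G] [CompactSpace G] [BorelSpace G]
    (r : LatticeRep G) (sch : SpeciesScheme (YMSpecies G))
    (k n : ℕ) (σ : Fin n → YMSpecies G) (f : Fin n → 𝓢(𝔼, ℝ)) {i : Fin n}
    (hi : σ i ≠ r.curvature) :
    latticeSchwinger r.ρ (canon r sch) (fun s => s.F) k n σ f = 0 := by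
  classical
  unfold latticeSchwinger
  have hc : (canon r sch).c (σ i) k = 0 := by simp [canon, hi]
  have h0 : ∀ U : GaugeConfig 4 ((canon r sch).side k) G,
      ∏ j, smearedLatticeField ((fun s : YMSpecies G => s.F) (σ j)) (box 4 ((canon r sch).L k))
        ((canon r sch).a k) ((canon r sch).c (σ j) k) ((canon r sch).m (σ j) k) (f j)
        (torusLift ((canon r sch).side k) U) = 0 := by
    intro U
    refine Finset.prod_eq_zero (Finset.mem_univ i) ?_
    simp [smearedLatticeField, hc]
  simp_rw [h0]
  simp

/-- On curvature strings the canonical lattice Schwinger function IS `curvNPoint` (definitional). -/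
theorem latticeSchwinger_canon_curv (r : LatticeRep G) (sch : SpeciesScheme (YMSpecies G)) (k n : ℕ)
    (f : Fin n → 𝓢(𝔼, ℝ)) :
    latticeSchwinger r.ρ (canon r sch) (fun s => s.F) k n (fun _ => r.curvature) f = curvNPoint r sch k n f :=
  rfl

/-- The dichotomy used by the zero-extension: a label string is the curvature string or touches another species. -/
theorem labels_dichotomy (r : LatticeRep G) {n : ℕ} (σ : Fin n → YMSpecies G) :
    σ = (fun _ => r.curvature) ∨ ∃ i, σ i ≠ r.curvature := by
  by_cases h : ∀ i, σ i = r.curvature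
  · exact Or.inl (funext h)
  · push Not at h; exact Or.inr h

/-- **Registered representative of this file** (closed form of `curvDistribution_tensor`, for the gate's
`--supports` stub check): on a real product tensor the canonical distribution is the canonical `p`-point function. -/
theorem osLegsA_curvDistribution_tensor :
    ∀ {G : Type} [Group G] [TopologicalSpace G] [IsTopologicalGroup G] [CompactSpace G]
      [MeasurableSpace G] [BorelSpace G] (r : LatticeRep G) (sch : SpeciesScheme (YMSpecies G)) (k p : ℕ)
      {F : 𝓢((Fin p → EuclideanSpace ℝ (Fin 4)), ℂ)} {f : Fin p → 𝓢(EuclideanSpace ℝ (Fin 4), ℝ)},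
      IsTensorOf F (fun i => ofRealTest (f i)) → curvDistribution r sch k p F = ((curvNPoint r sch k p f : ℝ) : ℂ) := by
  intro G _ _ _ _ _ _ r sch k p F f hF
  exact curvDistribution_tensor r sch k p hF

end Lattice


end Summit.QuantumFields.YangMills.Cruxes.ContinuumLimitOnTrajectory.TwoOrbitSynchronisation

end
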